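import Mathlib
import HarnessLib
import Summits.Langlands.Langlands.Theses.SkinnerWilesDefectOne
import Summits.Langlands.Langlands.Theorems.SkinnerWilesDefectOneSeedOfQuadraticBaseChangeS4Rewire
import Summits.Langlands.Langlands.Theorems.SkinnerWilesDefectOneSeedOfQuadraticBaseChangeInertSupplyAll
import Summits.Langlands.Langlands.Theorems.SkinnerWilesDefectOneSeedOfQuadraticBaseChangeEisensteinPackageQOdd
import Summits.Langlands.Langlands.Theorems.SkinnerWilesDefectOneEisensteinProModularSeedDistinguishedDescendsQ
import Summits.Langlands.Langlands.Theorems.SkinnerWilesDefectOneEisensteinProModularSeedRestrictTwistGaloisPackageNu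
import Summits.Langlands.Langlands.Theorems.SkinnerWilesDefectOneEisensteinProModularSeedCuspidalCohomologicalPoint

/-!
# Item `SeedOfQuadraticBaseChange` (stmt-Langlands-15158, route `SkinnerWilesDefectOne`):
# the closing composition for EVERY ODD `p` — the item modulo GENUINE residual pairs alone

`…Theorems.SkinnerWilesDefectOneSeedOfQuadraticBaseChange` (p95442) proves the item
`SeedOfQuadraticBaseChange : QuadraticBaseChangeGalois → EisensteinProModularSeed` modulo seven named
facts and the hypothesis `hgen` = the seed crux on the complement of the regime "`p ≥ 5` AND the
residual ratio descends to an odd character of `Γ_ℚ`" — so `hgen` still contained every `p = 3`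
datum, descended or not.  With Billerey–Menares 2016 Thm. 2.2 rendered for every odd `l`
(`Literature.NumberTheory.EllipticCurves.BillereyMenares2016_thm22_exists_newform_odd`, the
`ℚ`-side package `eisensteinPackageQ_odd` and the inert supply `inertSupplyPrimeSq_all` of the
companion files), the odd-descended chain S1' → S0 → S2' → S3-Nu → S4 (from `hQ`, p94876) → S5 runs
for every odd `p` (`seed_of_descends_of_quadraticBaseChangeGalois`), and the item holds modulo the
seven named facts (the `p ≥ 5` Billerey–Menares fact replaced by its odd-`l` form, of which it is a
corollary: `billereyMenares2016_thm22_of_odd`) and ONE open hypothesis `hgen'`: the seed crux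
`EisensteinProModularSeed` VERBATIM on residual pairs `(χ̄_a, χ̄_b)` whose ratio does NOT descend to
an odd continuous unit-valued character of `Γ_ℚ` — the GENUINE pairs, for every odd `p`
(`seedOfQuadraticBaseChange_of_genuineSeed`).  `hgen'` is an open statement (the heart of crux
stmt-Langlands-12920; truth unknown, cf. the crux's Disproof §7D/§8F), an explicit hypothesis here.
-/

set_option linter.dupNamespace false -- project-wide option (lakefile weak.linter.dupNamespace); `Summit.Langlands.Langlands` is the mandated namespace

noncomputable section

namespace Summit.Langlands.Langlands.Theorems.SkinnerWilesDefectOne.SeedOfQuadraticBaseChange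

open Summit.Langlands.Langlands.Theses.SkinnerWilesDefectOne
open Summit.Langlands.Langlands.Theorems.SkinnerWilesDefectOne.EisensteinProModularSeed
open Literature.NumberTheory.Automorphic Literature.NumberTheory.GaloisRepresentations
open Literature.NumberTheory.Automorphic.BigHeckeGLn
open NumberField IsDedekindDomain IsLocalRing Filter Field

/-- **The landed `p ≥ 5` rendering of Billerey–Menares 2016 Thm. 2.2 is a corollary of the odd-`l`
rendering.**  On the Billerey–Menares weights `k ∈ {p, p + 1} ∪ [3, p - 1]` with `p ≥ 5`, the von
Staudt antecedent `(p - 1) ∣ k` of the odd form forces `k = p - 1` (`(p-1) ∤ p` and `(p-1) ∤ (p+1)`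
for `p ≥ 5`), i.e. the antecedent `k + 1 = p` of the landed form; everything else is identical. -/
theorem billereyMenares2016_thm22_of_odd
    (h : Literature.NumberTheory.EllipticCurves.BillereyMenares2016_thm22_exists_newform_odd) :
    Literature.NumberTheory.EllipticCurves.BillereyMenares2016_thm22_exists_newform := by
  intro p _ hp5 ι η k M hunit hodd hk hinert hMp hMne hMunr hMcong hvs
  refine h p (by omega) ι η k M hunit hodd hk hinert hMp hMne hMunr hMcong fun hdvd hglob => ?_
  refine hvs ?_ hglob
  rcases hk with hk₁ | hk₂ | ⟨hk3, hkp⟩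
  · -- `(p - 1) ∣ p` forces `p - 1 = 1`
    rw [hk₁] at hdvd
    have h1 : (p - 1) ∣ p - (p - 1) := Nat.dvd_sub hdvd dvd_rfl
    rw [show p - (p - 1) = 1 by omega, Nat.dvd_one] at h1
    omega
  · -- `(p - 1) ∣ (p + 1)` forces `p - 1 ≤ 2`
    rw [hk₂] at hdvd
    have h1 : (p - 1) ∣ (p + 1) - (p - 1) := Nat.dvd_sub hdvd dvd_rfl
    rw [show (p + 1) - (p - 1) = 2 by omega] at h1
    have := Nat.le_of_dvd two_pos h1
    omega
  · -- `(p - 1) ∣ k` with `3 ≤ k ≤ p - 1` forces `k = p - 1`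
    have := Nat.le_of_dvd (by omega) hdvd
    omega

/-- **The odd-descended regime for EVERY ODD `p`, given quadratic base change.**  For `F` imaginary
quadratic, `p ≠ 2`, `O = 𝒪_{ℚ̄_p}`, ANY continuous `ρ : Γ_F → GL₂(ℚ̄_p)` with a residually
upper-triangular integral model `ρ₀`, unramified a.e. and `p`-distinguished at every `v ∣ p`, and a
continuous unit-valued `η : Γ_ℚ → ℚ̄_pˣ` with ODD reduction and the DESCENT relation
`η̄(σ|_ℚ)χ̄_a(σ) = χ̄_b(σ)` on `Γ_F`: granted `QuadraticBaseChangeGalois` and the seven named facts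
(Billerey–Menares in its odd-`l` form), the seed's conclusion holds for `ρ₀`.  Chain
`inertSupplyPrimeSq_all` → S0 → `eisensteinPackageQ_odd` → S3-Nu → S4 (from `hQ`) → S5. -/
theorem seed_of_descends_of_quadraticBaseChangeGalois
    (hQ : QuadraticBaseChangeGalois)
    (f₁ : Literature.NumberTheory.EllipticCurves.BillereyMenares2016_thm22_exists_newform_odd)
    (f₂ : Literature.NumberTheory.EllipticCurves.Hida2000_thm326_exists_galoisRep)
    (f₃ : Literature.NumberTheory.EllipticCurves.Hida2000_thm326_ordinary_unitRoot)
    (f₄ : Literature.NumberTheory.EllipticCurves.Hida2000_thm326_inertia_of_level)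
    (f₅ : Literature.NumberTheory.EllipticCurves.Gelbart1975_exists_cuspidalRepData_LAlgebraic)
    (e₁ : Literature.NumberTheory.Automorphic.bianchi_cuspidal_regularLAlgebraic_eigenclassExists)
    (e₂ : Literature.NumberTheory.Automorphic.algebraicWeightEigenclass_continuousPoint)
    (F : Type) [Field F] [NumberField F] (hF : IsTotallyComplex F) (hdeg : Module.finrank ℚ F = 2)
    (p : ℕ) [Fact p.Prime] (hp2 : p ≠ 2) (O : ValuationSubring (PadicAlgCl p))
    (hO : O = (Valued.v : Valuation (PadicAlgCl p) NNReal).valuationSubring)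
    (ρ : FramedGaloisRep F (PadicAlgCl p) 2) (ρ₀ : absoluteGaloisGroup F →* Matrix.GeneralLinearGroup (Fin 2) O)
    (hunr : ∀ᶠ v in cofinite, ρ.IsUnramifiedAt v) (hmod : ρ.HasUpperTriangularIntegralModel ρ₀)
    (hdist : ∀ v : HeightOneSpectrum (𝓞 F), (p : 𝓞 F) ∈ v.asIdeal → IsPDistinguishedAt ρ₀ v)
    (η : absoluteGaloisGroup ℚ →ₜ* (PadicAlgCl p)ˣ)
    (hU : ∀ τ, Valued.v ((η τ : (PadicAlgCl p)ˣ) : PadicAlgCl p) = 1)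
    (hD : ∀ σ : absoluteGaloisGroup F,
      Valued.v (((η (absGaloisRestrict ℚ F σ) : (PadicAlgCl p)ˣ) : PadicAlgCl p) *
          ((ρ₀ σ).val 0 0 : PadicAlgCl p) - ((ρ₀ σ).val 1 1 : PadicAlgCl p)) < 1)
    (hodd : ∀ c : absoluteGaloisGroup ℚ, IsComplexConjugation (Rat.castHom ℝ) c →
      Valued.v (((η c : (PadicAlgCl p)ˣ) : PadicAlgCl p) + 1) < 1) :
    ∃ (𝒰 : TameLevel 2 F p) (r : FramedGaloisRep F (PadicAlgCl p) 2)
      (r₀ : absoluteGaloisGroup F →* Matrix.GeneralLinearGroup (Fin 2) O)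
      (q : HeightOneSpectrum (𝓞 F)),
      r.toGaloisRep.IsIrreducible ∧ 𝒰.IsPadicallyAutomorphic r ∧
      r.HasUpperTriangularIntegralModel r₀ ∧
      (∀ g, ((r₀ g).val 0 0 - (ρ₀ g).val 0 0 : O) ∈ maximalIdeal O ∧
        ((r₀ g).val 1 1 - (ρ₀ g).val 1 1 : O) ∈ maximalIdeal O) ∧
      (∃ k : ℕ, 2 ≤ k ∧ ∃ m : ℕ, 0 < m ∧ ∀ v : HeightOneSpectrum (𝓞 F), (p : 𝓞 F) ∈ v.asIdeal →
        ∃ Q : Matrix.GeneralLinearGroup (Fin 2) (PadicAlgCl p),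
          Valued.v (Q.val 0 0) ≤ Valued.v (Q.val 1 0) ∧
          ∀ σ, (Q⁻¹ * r.toLocal v σ * Q).val 1 0 = 0 ∧
            (σ ∈ absInertia (v.adicCompletion F) →
              (Q⁻¹ * r.toLocal v σ * Q).val 1 1 ^ m = 1 ∧
              (Q⁻¹ * r.toLocal v σ * Q).val 0 0 ^ m =
                algebraMap (Padic p) (PadicAlgCl p)
                  (((GaloisRep.cyclotomicCharacter (v.adicCompletion F) p σ).val : PadicInt p) :
                    Padic p) ^ ((k - 1) * m))) ∧
      (∀ v : HeightOneSpectrum (𝓞 F), v ≠ q → (p : 𝓞 F) ∉ v.asIdeal →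
        (∀ 𝔓 ∈ v.primesAbove, ∀ σ ∈ 𝔓.inertia (absoluteGaloisGroup F),
          ((ρ₀ σ).val 0 0 - 1 : O) ∈ maximalIdeal O ∧ ((ρ₀ σ).val 1 1 - 1 : O) ∈ maximalIdeal O) →
        v ∉ 𝒰.bad) := by
  -- S1' (every prime): a level-raising prime `M ≡ -1 (mod p²)`, inert in `F`, `η̄(Frob_M) = -1`
  obtain ⟨M, hMp, hMne, hMinert, hMunr, hMfrob, hMsq⟩ := inertSupplyPrimeSq_all F hF hdeg p η hU hodd
  -- S0: `p`-distinguishedness descends to `ℚ`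
  have hdistQ := stub_distinguishedDescendsQ F p O hO ρ ρ₀ hmod hdist η hU hD
  -- S2' (every odd prime): the Eisenstein-congruent ordinary newform over `ℚ` and its package
  obtain ⟨k, ρ', ρ'₀, hk, hirr', hmod', hdiag', hord', hlev', hmodular⟩ :=
    eisensteinPackageQ_odd f₁ f₂ f₃ f₄ f₅ p hp2 O hO η M hU hodd hdistQ hMp hMne hMunr hMfrob hMsq
  -- S3-Nu: restrict to `Γ_F`, twist by the Teichmüller lift of `χ̄_a`, frames, level set `S`, `q`
  obtain ⟨r, r₀, ν, q, S, hν, hrν, hrirr, hrmod, hrdiag, hrord, hSfin, hSp, hSunr, hνS, hSlev⟩ :=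
    stub_restrictTwistGaloisPackageNu F hF hdeg p O hO ρ ρ₀ hunr hmod hdist η M k ρ' ρ'₀ hU hD hMp
      hMinert hk hirr' hmod' hdiag' hord' hlev'
  -- S2''s modularity clause over `ℚ`, then S4 from `hQ`: quadratic base change + twist
  obtain ⟨ι, π, T, hT, hTL, hTR, hcompat⟩ := hmodular (isCompact_glFiniteIntegralLevel_holds 2 ℚ)
  obtain ⟨πF, T', hT', hT'L, hT'R, hcompatF⟩ :=
    stub_quadraticBaseChangeTwist_of_quadraticBaseChangeGalois hQ F hF hdeg p
      (isCompact_glFiniteIntegralLevel_holds 2 ℚ) ι π T hT hTL hTR ρ' hcompat ν hν r hrν hrirr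
      S hSfin hSp hSunr hνS (isCompact_glFiniteIntegralLevel_holds 2 F)
  -- S5: the dictionary — a continuous `ℚ̄_p`-point of `𝕋(𝒰)`, `𝒰.bad = S`
  obtain ⟨𝒰, hbad, hpa⟩ :=
    stub_cuspidalCohomologicalPoint e₁ e₂ F hF hdeg p (isCompact_glFiniteIntegralLevel_holds 2 F) ι
      πF T' hT' hT'L hT'R S hSfin hSp r hcompatF
  exact ⟨𝒰, r, r₀, q, hrirr, hpa, hrmod, hrdiag, hrord, fun v hvq hvp hur => hbad ▸ hSlev v hvq hvp hur⟩

/-- **The item modulo GENUINE pairs** (closing composition of stmt-Langlands-15158 for every odd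
`p`, conditional).  Granted the seven named facts `f₁ … f₅, e₁, e₂` (published theorems, Literature
`def`s; `f₁` = Billerey–Menares 2016 Thm. 2.2 in its odd-`l` form) and `hgen'` — the seed crux
`EisensteinProModularSeed` VERBATIM under the extra hypothesis that the residual ratio of `ρ₀` does
NOT descend to an odd continuous unit-valued character of `Γ_ℚ` (the GENUINE pairs; no condition on
the odd prime `p`; an explicit hypothesis, NOT a named fact: its truth is unknown) —
`SeedOfQuadraticBaseChange` holds: unfold, take `hQ : QuadraticBaseChangeGalois`, split on descent;
the descended case is `seed_of_descends_of_quadraticBaseChangeGalois`, the genuine case is `hgen'`. -/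
theorem seedOfQuadraticBaseChange_of_genuineSeed
    (f₁ : Literature.NumberTheory.EllipticCurves.BillereyMenares2016_thm22_exists_newform_odd)
    (f₂ : Literature.NumberTheory.EllipticCurves.Hida2000_thm326_exists_galoisRep)
    (f₃ : Literature.NumberTheory.EllipticCurves.Hida2000_thm326_ordinary_unitRoot)
    (f₄ : Literature.NumberTheory.EllipticCurves.Hida2000_thm326_inertia_of_level)
    (f₅ : Literature.NumberTheory.EllipticCurves.Gelbart1975_exists_cuspidalRepData_LAlgebraic)
    (e₁ : Literature.NumberTheory.Automorphic.bianchi_cuspidal_regularLAlgebraic_eigenclassExists)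
    (e₂ : Literature.NumberTheory.Automorphic.algebraicWeightEigenclass_continuousPoint)
    (hgen' : ∀ (F : Type) [Field F] [NumberField F], NumberField.IsTotallyComplex F → Module.finrank ℚ F = 2 →
      ∀ (p : ℕ) [Fact p.Prime], p ≠ 2 → ∀ (O : ValuationSubring (PadicAlgCl p)),
      O = (Valued.v : Valuation (PadicAlgCl p) NNReal).valuationSubring →
      ∀ (ρ : Literature.NumberTheory.GaloisRepresentations.FramedGaloisRep F (PadicAlgCl p) 2)
        (ρ₀ : Field.absoluteGaloisGroup F →* Matrix.GeneralLinearGroup (Fin 2) O),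
      ρ.toGaloisRep.IsIrreducible → (∀ᶠ v in Filter.cofinite, ρ.IsUnramifiedAt v) →
      ρ.HasUpperTriangularIntegralModel ρ₀ →
      (∃ k : ℕ, 2 ≤ k ∧ ∃ m : ℕ, 0 < m ∧ ∀ v : IsDedekindDomain.HeightOneSpectrum (NumberField.RingOfIntegers F), (p : NumberField.RingOfIntegers F) ∈ v.asIdeal →
        Literature.NumberTheory.GaloisRepresentations.IsPDistinguishedAt ρ₀ v ∧ ∃ Q : Matrix.GeneralLinearGroup (Fin 2) (PadicAlgCl p),
          Valued.v (Q.val 0 0) ≤ Valued.v (Q.val 1 0) ∧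
          ∀ σ, (Q⁻¹ * ρ.toLocal v σ * Q).val 1 0 = 0 ∧
            (σ ∈ Literature.NumberTheory.GaloisRepresentations.absInertia (v.adicCompletion F) →
              (Q⁻¹ * ρ.toLocal v σ * Q).val 1 1 ^ m = 1 ∧
              (Q⁻¹ * ρ.toLocal v σ * Q).val 0 0 ^ m =
                algebraMap (Padic p) (PadicAlgCl p)
                  (((Literature.NumberTheory.GaloisRepresentations.GaloisRep.cyclotomicCharacter (v.adicCompletion F) p σ).val : PadicInt p) :
                    Padic p) ^ ((k - 1) * m))) →
      ¬ (∃ η : Field.absoluteGaloisGroup ℚ →ₜ* (PadicAlgCl p)ˣ,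
      (∀ τ, Valued.v ((η τ : (PadicAlgCl p)ˣ) : PadicAlgCl p) = 1) ∧
      (∀ σ : Field.absoluteGaloisGroup F,
        Valued.v (((η (Literature.NumberTheory.GaloisRepresentations.absGaloisRestrict ℚ F σ) : (PadicAlgCl p)ˣ) : PadicAlgCl p) *
            ((ρ₀ σ).val 0 0 : PadicAlgCl p) - ((ρ₀ σ).val 1 1 : PadicAlgCl p)) < 1) ∧
      (∀ c : Field.absoluteGaloisGroup ℚ, Literature.NumberTheory.GaloisRepresentations.IsComplexConjugation (Rat.castHom ℝ) c →
        Valued.v (((η c : (PadicAlgCl p)ˣ) : PadicAlgCl p) + 1) < 1)) →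
      ∃ (𝒰 : Literature.NumberTheory.Automorphic.BigHeckeGLn.TameLevel 2 F p) (r : Literature.NumberTheory.GaloisRepresentations.FramedGaloisRep F (PadicAlgCl p) 2)
        (r₀ : Field.absoluteGaloisGroup F →* Matrix.GeneralLinearGroup (Fin 2) O)
        (q : IsDedekindDomain.HeightOneSpectrum (NumberField.RingOfIntegers F)),
        r.toGaloisRep.IsIrreducible ∧ 𝒰.IsPadicallyAutomorphic r ∧
        r.HasUpperTriangularIntegralModel r₀ ∧
        (∀ g, ((r₀ g).val 0 0 - (ρ₀ g).val 0 0 : O) ∈ IsLocalRing.maximalIdeal O ∧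
          ((r₀ g).val 1 1 - (ρ₀ g).val 1 1 : O) ∈ IsLocalRing.maximalIdeal O) ∧
        (∃ k : ℕ, 2 ≤ k ∧ ∃ m : ℕ, 0 < m ∧ ∀ v : IsDedekindDomain.HeightOneSpectrum (NumberField.RingOfIntegers F), (p : NumberField.RingOfIntegers F) ∈ v.asIdeal →
          ∃ Q : Matrix.GeneralLinearGroup (Fin 2) (PadicAlgCl p),
            Valued.v (Q.val 0 0) ≤ Valued.v (Q.val 1 0) ∧
            ∀ σ, (Q⁻¹ * r.toLocal v σ * Q).val 1 0 = 0 ∧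
              (σ ∈ Literature.NumberTheory.GaloisRepresentations.absInertia (v.adicCompletion F) →
                (Q⁻¹ * r.toLocal v σ * Q).val 1 1 ^ m = 1 ∧
                (Q⁻¹ * r.toLocal v σ * Q).val 0 0 ^ m =
                  algebraMap (Padic p) (PadicAlgCl p)
                    (((Literature.NumberTheory.GaloisRepresentations.GaloisRep.cyclotomicCharacter (v.adicCompletion F) p σ).val : PadicInt p) :
                      Padic p) ^ ((k - 1) * m))) ∧
        (∀ v : IsDedekindDomain.HeightOneSpectrum (NumberField.RingOfIntegers F), v ≠ q → (p : NumberField.RingOfIntegers F) ∉ v.asIdeal →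
          (∀ 𝔓 ∈ v.primesAbove, ∀ σ ∈ 𝔓.inertia (Field.absoluteGaloisGroup F),
            ((ρ₀ σ).val 0 0 - 1 : O) ∈ IsLocalRing.maximalIdeal O ∧ ((ρ₀ σ).val 1 1 - 1 : O) ∈ IsLocalRing.maximalIdeal O) →
          v ∉ 𝒰.bad)) :
    SeedOfQuadraticBaseChange := by
  unfold SeedOfQuadraticBaseChange
  intro hQ F _ _ hF hdeg p _ hp O hO ρ ρ₀ hirr hunr hmod hloc
  by_cases hP : ∃ η : absoluteGaloisGroup ℚ →ₜ* (PadicAlgCl p)ˣ,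
      (∀ τ, Valued.v ((η τ : (PadicAlgCl p)ˣ) : PadicAlgCl p) = 1) ∧
      (∀ σ : absoluteGaloisGroup F,
        Valued.v (((η (absGaloisRestrict ℚ F σ) : (PadicAlgCl p)ˣ) : PadicAlgCl p) *
            ((ρ₀ σ).val 0 0 : PadicAlgCl p) - ((ρ₀ σ).val 1 1 : PadicAlgCl p)) < 1) ∧
      (∀ c : absoluteGaloisGroup ℚ, IsComplexConjugation (Rat.castHom ℝ) c →
        Valued.v (((η c : (PadicAlgCl p)ˣ) : PadicAlgCl p) + 1) < 1)
  · obtain ⟨η, hU, hD, hodd⟩ := hP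
    have hdist : ∀ v : HeightOneSpectrum (𝓞 F), (p : 𝓞 F) ∈ v.asIdeal → IsPDistinguishedAt ρ₀ v := by
      obtain ⟨k₀, -, m₀, -, hloc'⟩ := hloc
      exact fun v hv => (hloc' v hv).1
    exact seed_of_descends_of_quadraticBaseChangeGalois hQ f₁ f₂ f₃ f₄ f₅ e₁ e₂ F hF hdeg p hp O hO
      ρ ρ₀ hunr hmod hdist η hU hD hodd
  · exact hgen' F hF hdeg p hp O hO ρ ρ₀ hirr hunr hmod hloc hP

end Summit.Langlands.Langlands.Theorems.SkinnerWilesDefectOne.SeedOfQuadraticBaseChange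

end
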